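/-
COR-CM (cell pub-hodgecm2, stage 2 of the Hodge ladder) — count-neutral KERNEL COMBINATORICS «the named composite cyclotomic fields, II»
(seat prover-pub-hodgecm2-b23-g39-0, binder prover b23, gen 39; claim ABELIAN-DATUM D3, II, HOME/INBOX.md l.9432; blanket `CorCM/FaceCyclotomic*`).
Theorems only: the datum-free cyclotomic packaging of `CorCM/FaceAbelianSlices.lean` (D2) with this seat's gen-37 numeric instances
(`Census/EvenSliceFaceTransportCounts{,B}.lean`) BY NAME; the unit tables are checked by `decide +kernel`; no geometry, no named fact, nothing
asserted; `Interfaces.lean` (C1), every E term, B01 and `Transposition/*` are untouched.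
HONEST FRAMING (COORDINATOR RULING — HODGE FRAMING CORRECTION, 2026-08-21T11:55:35Z): `HC_CM` is NOT proved, here or anywhere in the
tree; every `HodgeConjectureFor` below is CONDITIONAL on face periods; no period is produced.
T5: n/a-class — the only Prop hypothesis binder displayed is INT2-GEN's period hypothesis on the produced face set; checker: self
(prover-pub-hodgecm2-b23-g39-0), 2026-08-22.
-/
import Summits.HodgeConjecture.CorCM.FaceAbelianSlices
import Summits.HodgeConjecture.CorCM.Census.EvenSliceFaceTransportCounts
import Summits.HodgeConjecture.CorCM.Census.EvenSliceFaceTransportCountsB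
import HarnessLib

/-!
# The named composite cyclotomic CM fields, II: `ℚ(ζ₃₂), ℚ(ζ₃₃), ℚ(ζ₃₆), ℚ(ζ₄₀), ℚ(ζ₄₄)` — datum-free face sets

Continuation of `CorCM/FaceCyclotomicComposite.lean` (`ℚ(ζ₁₅), ℚ(ζ₁₆), ℚ(ζ₂₀), ℚ(ζ₂₁), ℚ(ζ₂₄), ℚ(ζ₂₈)`; companion `CorCM/FaceCyclotomicCompositeC.lean` for `ℚ(ζ₃₅), ℚ(ζ₃₉), ℚ(ζ₄₅), ℚ(ζ₄₈), ℚ(ζ₆₀)`) with the same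
mechanism: D1 `FaceAbelian.autEquivPow_conjAut` (complex conjugation `= −1 ∈ (ℤ/N)ˣ`), D1 `exists_addChar_of_not_isSquare` (`−1 ∉ ((ℤ/N)ˣ)²` gives
the detecting character), D2 `exists_autDatum_cyclotomic_of_unitTable` from a unit table `(ℤ/N)ˣ → A` presenting `(ℤ/N)ˣ/±1`, each property a
`decide +kernel`; then gen 37's numeric instance for `A`.  NO hypothesis beyond `[IsCyclotomicExtension {N} ℚ K]`.

| `N` | `[K:ℚ]` | why `−1 ∉ ((ℤ/N)ˣ)²` | `A = Aut(K)/⟨c⟩ ≅ Gal(K⁺/ℚ)` | `#OrbitsA A` | faces |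
|---|---|---|---|---|---|
| 32 | 16 | `4 ∣ 32` | `ℤ/8` | 19 | ≤ 18 |
| 33 | 20 | `3, 11 ≡ 3 (mod 4)` divide | `ℤ/10` | 55 | ≤ 54 |
| 36 | 12 | `4 ∣ 36` | `ℤ/6` | 7 | ≤ 6 |
| 40 | 16 | `4 ∣ 40` | `ℤ/2 × ℤ/4` | 23 | ≤ 22 |
| 44 | 20 | `4 ∣ 44` | `ℤ/10` | 55 | ≤ 54 |
Each `exists_faceSet_cyclotomic_<N>`: for `K` ANY CM field that is an `N`-th cyclotomic extension of `ℚ` and any complex embedding `σ₀`,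
a face set `𝒮` of `K` of at most the stated size EXISTS such that ONE period witness per face of `𝒮` on the universe of record implies the
Hodge conjecture, in every codimension, for every complex abelian variety dominated by a finite product of abelian varieties realising CM
types of CM fields embeddable in `K` — CONDITIONAL; `HC_CM` is NOT proved, no period is produced.

References: [cite: Washington1997, Thm. 2.5]; [cite: Pohlmann1968, Thm. 1]; [cite: Milne1999LefschetzClasses, Thm. 3.2 and Cor. 4.5];
[cite: Shimura1998, §6.2 Theorem 3 and §6.1 Corollary of Theorem 2 (pp. 41–43)]; [cite: MumfordAV1970, §19 Thm. 1 and p. 169].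
-/

noncomputable section

open CategoryTheory NumberField NumberField.ComplexEmbedding
open Literature.AlgebraicGeometry Literature.AlgebraicGeometry.Motives Literature.AlgebraicGeometry.HodgeTheory
open Literature.AlgebraicGeometry.ComplexMultiplication Literature.AlgebraicGeometry.Milne1999
open Literature.NumberTheory.Automorphic
open Literature.NumberTheory.Automorphic.PicardCM
open Summit.HodgeConjecture.CorCM.Domination

namespace Summit.HodgeConjecture.CorCM.FaceAbelian

/-- **`ℚ(ζ₃₂)` (degree `16`, `Aut ≅ (ℤ/32)ˣ`, `A ≅ ℤ/8`, `19` orbits): at most `18` faces** whose periods give HC of the slice — no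
datum hypothesis (`4 ∣ 32`; unit table = cosets `3^k·{±1} ↦ k`).  CONDITIONAL; `HC_CM` is NOT proved.
[cite: Washington1997, Thm. 2.5] [cite: Shimura1998, §6.2 Theorem 3 and §6.1 Corollary of Theorem 2 (pp. 41–43)]
[cite: Pohlmann1968, Thm. 1] [cite: Milne1999LefschetzClasses, Thm. 3.2 and Cor. 4.5] [cite: MumfordAV1970, §19 Thm. 1 and p. 169] -/
theorem exists_faceSet_cyclotomic_thirtyTwo (K : CMField) [IsCyclotomicExtension {32} ℚ (K : Type)] (σ₀ : (K : Type) →+* ℂ) :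
    ∃ 𝒮 : Finset (Face K), 𝒮.card ≤ 18 ∧
      ((∀ f ∈ 𝒮, ∃ ι₁ : K →+* ℂ, f.Admissible ι₁ ∧ ∃ (V : HermSpace3 K ι₁) (σ : K →+* ℂ),
        (Model.picardCMUniverse exists_isReal_hodgeModel_holds hodgePQ_independent_of_hodgeModel_holds
          BallQuotient.ballQuotientUniformised_holds cmAbelianVarietyRealised_holds).PeriodNV ι₁ V K f.psi σ) →
      ∀ {P B : AbelianVariety ℂ}, AbelianVariety.IsProductOf (fun B : AbelianVariety ℂ =>
        ∃ (E : Type) (_ : Field E) (_ : NumberField E) (_ : IsCMField E) (_ : E →+* (K : Type)) (Φ : CMType E)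
          (ι : 𝓞 E →+* End B) (θ : E →+* Module.End ℂ (complexBetti B.X 1)),
          IsCMTypeRealisation Φ B ι θ) P →
      AVDominatedBy B P → HodgeConjectureFor B.dim B.X) := by
  haveI : IsGalois ℚ (K : Type) := IsCyclotomicExtension.isGalois {32} ℚ (K : Type)
  obtain ⟨c, ε, hcσ, hε, hεc⟩ := exists_autDatum_cyclotomic_of_unitTable (K : Type) (N := 32) (A := ZMod 8) (by decide +kernel)
    (fun u : (ZMod 32)ˣ =>
      if (u : ZMod 32).val = 1 ∨ (u : ZMod 32).val = 31 then (0 : ZMod 8) else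
      if (u : ZMod 32).val = 3 ∨ (u : ZMod 32).val = 29 then (1 : ZMod 8) else
      if (u : ZMod 32).val = 9 ∨ (u : ZMod 32).val = 23 then (2 : ZMod 8) else
      if (u : ZMod 32).val = 5 ∨ (u : ZMod 32).val = 27 then (3 : ZMod 8) else
      if (u : ZMod 32).val = 15 ∨ (u : ZMod 32).val = 17 then (4 : ZMod 8) else
      if (u : ZMod 32).val = 13 ∨ (u : ZMod 32).val = 19 then (5 : ZMod 8) else
      if (u : ZMod 32).val = 7 ∨ (u : ZMod 32).val = 25 then (6 : ZMod 8) else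
      (7 : ZMod 8))
    (by decide +kernel) (by decide +kernel) (by decide +kernel) (by decide +kernel) σ₀
  exact exists_faceSet_evenSlice_zmod_eight K σ₀ ε hε hcσ hεc

/-- **`ℚ(ζ₃₃)` (degree `20`, `Aut ≅ (ℤ/33)ˣ`, `A ≅ ℤ/10`, `55` orbits): at most `54` faces** whose periods give HC of the slice — no
datum hypothesis (`3, 11 ≡ 3 (mod 4)` divide; unit table = cosets `5^k·{±1} ↦ k`).  CONDITIONAL; `HC_CM` is NOT proved.
[cite: Washington1997, Thm. 2.5] [cite: Shimura1998, §6.2 Theorem 3 and §6.1 Corollary of Theorem 2 (pp. 41–43)]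
[cite: Pohlmann1968, Thm. 1] [cite: Milne1999LefschetzClasses, Thm. 3.2 and Cor. 4.5] [cite: MumfordAV1970, §19 Thm. 1 and p. 169] -/
theorem exists_faceSet_cyclotomic_thirtyThree (K : CMField) [IsCyclotomicExtension {33} ℚ (K : Type)] (σ₀ : (K : Type) →+* ℂ) :
    ∃ 𝒮 : Finset (Face K), 𝒮.card ≤ 54 ∧
      ((∀ f ∈ 𝒮, ∃ ι₁ : K →+* ℂ, f.Admissible ι₁ ∧ ∃ (V : HermSpace3 K ι₁) (σ : K →+* ℂ),
        (Model.picardCMUniverse exists_isReal_hodgeModel_holds hodgePQ_independent_of_hodgeModel_holds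
          BallQuotient.ballQuotientUniformised_holds cmAbelianVarietyRealised_holds).PeriodNV ι₁ V K f.psi σ) →
      ∀ {P B : AbelianVariety ℂ}, AbelianVariety.IsProductOf (fun B : AbelianVariety ℂ =>
        ∃ (E : Type) (_ : Field E) (_ : NumberField E) (_ : IsCMField E) (_ : E →+* (K : Type)) (Φ : CMType E)
          (ι : 𝓞 E →+* End B) (θ : E →+* Module.End ℂ (complexBetti B.X 1)),
          IsCMTypeRealisation Φ B ι θ) P →
      AVDominatedBy B P → HodgeConjectureFor B.dim B.X) := by
  haveI : IsGalois ℚ (K : Type) := IsCyclotomicExtension.isGalois {33} ℚ (K : Type)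
  obtain ⟨c, ε, hcσ, hε, hεc⟩ := exists_autDatum_cyclotomic_of_unitTable (K : Type) (N := 33) (A := ZMod 10) (by decide +kernel)
    (fun u : (ZMod 33)ˣ =>
      if (u : ZMod 33).val = 1 ∨ (u : ZMod 33).val = 32 then (0 : ZMod 10) else
      if (u : ZMod 33).val = 5 ∨ (u : ZMod 33).val = 28 then (1 : ZMod 10) else
      if (u : ZMod 33).val = 8 ∨ (u : ZMod 33).val = 25 then (2 : ZMod 10) else
      if (u : ZMod 33).val = 7 ∨ (u : ZMod 33).val = 26 then (3 : ZMod 10) else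
      if (u : ZMod 33).val = 2 ∨ (u : ZMod 33).val = 31 then (4 : ZMod 10) else
      if (u : ZMod 33).val = 10 ∨ (u : ZMod 33).val = 23 then (5 : ZMod 10) else
      if (u : ZMod 33).val = 16 ∨ (u : ZMod 33).val = 17 then (6 : ZMod 10) else
      if (u : ZMod 33).val = 14 ∨ (u : ZMod 33).val = 19 then (7 : ZMod 10) else
      if (u : ZMod 33).val = 4 ∨ (u : ZMod 33).val = 29 then (8 : ZMod 10) else
      (9 : ZMod 10))
    (by decide +kernel) (by decide +kernel) (by decide +kernel) (by decide +kernel) σ₀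
  exact exists_faceSet_evenSlice_zmod_ten K σ₀ ε hε hcσ hεc

/-- **`ℚ(ζ₃₆)` (degree `12`, `Aut ≅ (ℤ/36)ˣ`, `A ≅ ℤ/6`, `7` orbits): at most `6` faces** whose periods give HC of the slice — no
datum hypothesis (`4 ∣ 36`; unit table = cosets `5^k·{±1} ↦ k`).  CONDITIONAL; `HC_CM` is NOT proved.
[cite: Washington1997, Thm. 2.5] [cite: Shimura1998, §6.2 Theorem 3 and §6.1 Corollary of Theorem 2 (pp. 41–43)]
[cite: Pohlmann1968, Thm. 1] [cite: Milne1999LefschetzClasses, Thm. 3.2 and Cor. 4.5] [cite: MumfordAV1970, §19 Thm. 1 and p. 169] -/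
theorem exists_faceSet_cyclotomic_thirtySix (K : CMField) [IsCyclotomicExtension {36} ℚ (K : Type)] (σ₀ : (K : Type) →+* ℂ) :
    ∃ 𝒮 : Finset (Face K), 𝒮.card ≤ 6 ∧
      ((∀ f ∈ 𝒮, ∃ ι₁ : K →+* ℂ, f.Admissible ι₁ ∧ ∃ (V : HermSpace3 K ι₁) (σ : K →+* ℂ),
        (Model.picardCMUniverse exists_isReal_hodgeModel_holds hodgePQ_independent_of_hodgeModel_holds
          BallQuotient.ballQuotientUniformised_holds cmAbelianVarietyRealised_holds).PeriodNV ι₁ V K f.psi σ) →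
      ∀ {P B : AbelianVariety ℂ}, AbelianVariety.IsProductOf (fun B : AbelianVariety ℂ =>
        ∃ (E : Type) (_ : Field E) (_ : NumberField E) (_ : IsCMField E) (_ : E →+* (K : Type)) (Φ : CMType E)
          (ι : 𝓞 E →+* End B) (θ : E →+* Module.End ℂ (complexBetti B.X 1)),
          IsCMTypeRealisation Φ B ι θ) P →
      AVDominatedBy B P → HodgeConjectureFor B.dim B.X) := by
  haveI : IsGalois ℚ (K : Type) := IsCyclotomicExtension.isGalois {36} ℚ (K : Type)
  obtain ⟨c, ε, hcσ, hε, hεc⟩ := exists_autDatum_cyclotomic_of_unitTable (K : Type) (N := 36) (A := ZMod 6) (by decide +kernel)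
    (fun u : (ZMod 36)ˣ =>
      if (u : ZMod 36).val = 1 ∨ (u : ZMod 36).val = 35 then (0 : ZMod 6) else
      if (u : ZMod 36).val = 5 ∨ (u : ZMod 36).val = 31 then (1 : ZMod 6) else
      if (u : ZMod 36).val = 11 ∨ (u : ZMod 36).val = 25 then (2 : ZMod 6) else
      if (u : ZMod 36).val = 17 ∨ (u : ZMod 36).val = 19 then (3 : ZMod 6) else
      if (u : ZMod 36).val = 13 ∨ (u : ZMod 36).val = 23 then (4 : ZMod 6) else
      (5 : ZMod 6))
    (by decide +kernel) (by decide +kernel) (by decide +kernel) (by decide +kernel) σ₀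
  exact exists_faceSet_evenSlice_zmod_six K σ₀ ε hε hcσ hεc

/-- **`ℚ(ζ₄₀)` (degree `16`, `Aut ≅ (ℤ/40)ˣ`, `A ≅ ℤ/2 × ℤ/4`, `23` orbits): at most `22` faces** whose periods give HC of the slice — no
datum hypothesis (`4 ∣ 40`; unit table from the unit pair `(11, 3)` ↦ `ℤ/2 × ℤ/4`).  CONDITIONAL; `HC_CM` is NOT proved.
[cite: Washington1997, Thm. 2.5] [cite: Shimura1998, §6.2 Theorem 3 and §6.1 Corollary of Theorem 2 (pp. 41–43)]
[cite: Pohlmann1968, Thm. 1] [cite: Milne1999LefschetzClasses, Thm. 3.2 and Cor. 4.5] [cite: MumfordAV1970, §19 Thm. 1 and p. 169] -/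
theorem exists_faceSet_cyclotomic_forty (K : CMField) [IsCyclotomicExtension {40} ℚ (K : Type)] (σ₀ : (K : Type) →+* ℂ) :
    ∃ 𝒮 : Finset (Face K), 𝒮.card ≤ 22 ∧
      ((∀ f ∈ 𝒮, ∃ ι₁ : K →+* ℂ, f.Admissible ι₁ ∧ ∃ (V : HermSpace3 K ι₁) (σ : K →+* ℂ),
        (Model.picardCMUniverse exists_isReal_hodgeModel_holds hodgePQ_independent_of_hodgeModel_holds
          BallQuotient.ballQuotientUniformised_holds cmAbelianVarietyRealised_holds).PeriodNV ι₁ V K f.psi σ) →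
      ∀ {P B : AbelianVariety ℂ}, AbelianVariety.IsProductOf (fun B : AbelianVariety ℂ =>
        ∃ (E : Type) (_ : Field E) (_ : NumberField E) (_ : IsCMField E) (_ : E →+* (K : Type)) (Φ : CMType E)
          (ι : 𝓞 E →+* End B) (θ : E →+* Module.End ℂ (complexBetti B.X 1)),
          IsCMTypeRealisation Φ B ι θ) P →
      AVDominatedBy B P → HodgeConjectureFor B.dim B.X) := by
  haveI : IsGalois ℚ (K : Type) := IsCyclotomicExtension.isGalois {40} ℚ (K : Type)
  obtain ⟨c, ε, hcσ, hε, hεc⟩ := exists_autDatum_cyclotomic_of_unitTable (K : Type) (N := 40) (A := ZMod 2 × ZMod 4) (by decide +kernel)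
    (fun u : (ZMod 40)ˣ =>
      if (u : ZMod 40).val = 1 ∨ (u : ZMod 40).val = 39 then ((0, 0) : ZMod 2 × ZMod 4) else
      if (u : ZMod 40).val = 3 ∨ (u : ZMod 40).val = 37 then ((0, 1) : ZMod 2 × ZMod 4) else
      if (u : ZMod 40).val = 9 ∨ (u : ZMod 40).val = 31 then ((0, 2) : ZMod 2 × ZMod 4) else
      if (u : ZMod 40).val = 13 ∨ (u : ZMod 40).val = 27 then ((0, 3) : ZMod 2 × ZMod 4) else
      if (u : ZMod 40).val = 11 ∨ (u : ZMod 40).val = 29 then ((1, 0) : ZMod 2 × ZMod 4) else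
      if (u : ZMod 40).val = 7 ∨ (u : ZMod 40).val = 33 then ((1, 1) : ZMod 2 × ZMod 4) else
      if (u : ZMod 40).val = 19 ∨ (u : ZMod 40).val = 21 then ((1, 2) : ZMod 2 × ZMod 4) else
      ((1, 3) : ZMod 2 × ZMod 4))
    (by decide +kernel) (by decide +kernel) (by decide +kernel) (by decide +kernel) σ₀
  exact exists_faceSet_evenSlice_zmod_two_four K σ₀ ε hε hcσ hεc

/-- **`ℚ(ζ₄₄)` (degree `20`, `Aut ≅ (ℤ/44)ˣ`, `A ≅ ℤ/10`, `55` orbits): at most `54` faces** whose periods give HC of the slice — no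
datum hypothesis (`4 ∣ 44`; unit table = cosets `3^k·{±1} ↦ k`).  CONDITIONAL; `HC_CM` is NOT proved.
[cite: Washington1997, Thm. 2.5] [cite: Shimura1998, §6.2 Theorem 3 and §6.1 Corollary of Theorem 2 (pp. 41–43)]
[cite: Pohlmann1968, Thm. 1] [cite: Milne1999LefschetzClasses, Thm. 3.2 and Cor. 4.5] [cite: MumfordAV1970, §19 Thm. 1 and p. 169] -/
theorem exists_faceSet_cyclotomic_fortyFour (K : CMField) [IsCyclotomicExtension {44} ℚ (K : Type)] (σ₀ : (K : Type) →+* ℂ) :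
    ∃ 𝒮 : Finset (Face K), 𝒮.card ≤ 54 ∧
      ((∀ f ∈ 𝒮, ∃ ι₁ : K →+* ℂ, f.Admissible ι₁ ∧ ∃ (V : HermSpace3 K ι₁) (σ : K →+* ℂ),
        (Model.picardCMUniverse exists_isReal_hodgeModel_holds hodgePQ_independent_of_hodgeModel_holds
          BallQuotient.ballQuotientUniformised_holds cmAbelianVarietyRealised_holds).PeriodNV ι₁ V K f.psi σ) →
      ∀ {P B : AbelianVariety ℂ}, AbelianVariety.IsProductOf (fun B : AbelianVariety ℂ =>
        ∃ (E : Type) (_ : Field E) (_ : NumberField E) (_ : IsCMField E) (_ : E →+* (K : Type)) (Φ : CMType E)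
          (ι : 𝓞 E →+* End B) (θ : E →+* Module.End ℂ (complexBetti B.X 1)),
          IsCMTypeRealisation Φ B ι θ) P →
      AVDominatedBy B P → HodgeConjectureFor B.dim B.X) := by
  haveI : IsGalois ℚ (K : Type) := IsCyclotomicExtension.isGalois {44} ℚ (K : Type)
  obtain ⟨c, ε, hcσ, hε, hεc⟩ := exists_autDatum_cyclotomic_of_unitTable (K : Type) (N := 44) (A := ZMod 10) (by decide +kernel)
    (fun u : (ZMod 44)ˣ =>
      if (u : ZMod 44).val = 1 ∨ (u : ZMod 44).val = 43 then (0 : ZMod 10) else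
      if (u : ZMod 44).val = 3 ∨ (u : ZMod 44).val = 41 then (1 : ZMod 10) else
      if (u : ZMod 44).val = 9 ∨ (u : ZMod 44).val = 35 then (2 : ZMod 10) else
      if (u : ZMod 44).val = 17 ∨ (u : ZMod 44).val = 27 then (3 : ZMod 10) else
      if (u : ZMod 44).val = 7 ∨ (u : ZMod 44).val = 37 then (4 : ZMod 10) else
      if (u : ZMod 44).val = 21 ∨ (u : ZMod 44).val = 23 then (5 : ZMod 10) else
      if (u : ZMod 44).val = 19 ∨ (u : ZMod 44).val = 25 then (6 : ZMod 10) else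
      if (u : ZMod 44).val = 13 ∨ (u : ZMod 44).val = 31 then (7 : ZMod 10) else
      if (u : ZMod 44).val = 5 ∨ (u : ZMod 44).val = 39 then (8 : ZMod 10) else
      (9 : ZMod 10))
    (by decide +kernel) (by decide +kernel) (by decide +kernel) (by decide +kernel) σ₀
  exact exists_faceSet_evenSlice_zmod_ten K σ₀ ε hε hcσ hεc

end Summit.HodgeConjecture.CorCM.FaceAbelian

end
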